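import Literature.AlgebraicGeometry.ModuliOfAbelianVarieties.SiegelShimuraSet
import Literature.AlgebraicGeometry.ModuliOfAbelianVarieties.SiegelPrincipalLevelFree
import Literature.NumberTheory.Adeles.CompactSubgroupStabilisesLattice
import Mathlib.Analysis.Matrix.PosDef
import Mathlib.Analysis.Normed.Module.FiniteDimension
import HarnessLib

/-!
# Bounds for rational transporters in `GSp_δ`: definite-form coordinate bounds, common denominators,
# `⋂ₙ n·ℤ̂ = 0`, `⋂ₖ K_δ(N·(k+1)!) = 1`, and the real relation `ᵗγ (ᵗJ E_δ) γ = ν·ᵗJ′E_δ` ([Deligne 1971] proof of Prop. 1.15)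

Topic `AlgebraicGeometry/ModuliOfAbelianVarieties`; namespace `Literature.AlgebraicGeometry.ModuliOfAbelianVarieties`.
Theorems only (no definition, no named fact, no instance, no `sorry`).  The elementary inputs of the finiteness of the
rational transporter `{γ ∈ GSp_δ(ℚ) | γJ′γ⁻¹ = J, a⁻¹γa′ ∈ K_δ(N)}` (sequel file ★ `SiegelRationalTransporterFinite`) and
of the injectivity step «un seul `q` sert pour une chaîne cofinale … `⋂ K = 1`» of [Deligne1971TravauxShimura] Prop. 1.15
(p. 132), run model-free for the Hodge-type embedding `U(H) × T₀ ↪ GSp_δ` (cell hodgecm-mathlib, row I-1′, `stub_S2inj`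
core; B-plan2 ruling 2026-08-28):

* §1 `exists_pos_forall_mul_sq_le_of_posDef` — a positive definite real form dominates `c·xᵢ²` (minimum on the compact unit
  sphere); `mul_sq_entry_le_of_transpose_mul_mul_eq` — `ᵗM S M = r S′ ⇒ c·M_{ki}² ≤ r·S′_{ii}`.
* §2 `finite_setOf_rat_den_le`, `finite_setOf_forall_entry_mem` — finitely many rationals (matrices) with bounded
  denominator and size.
* §3 `mem_integralAdeles_iff_forall`, `exists_nat_forall_mul_entry_mem_integralAdeles` (one natural number clears the
  entries of `a, a⁻¹, a′, a′⁻¹`, ★ `Adeles.exists_ne_zero_forall_mul_entry_mem`), `eq_zero_of_forall_mem_levelIdeal`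
  (`⋂ₙ n·ℤ̂ = 0`), **`eq_one_of_forall_mem_principalLevelSubgroup`** / `iInter_principalLevelSubgroup_factorial`
  (`⋂ₖ K_δ(N·(k+1)!) = {1}`), `mul_entry_mul_mul_mem_integralAdeles`.
* §4 `exists_sign_smul_posDef` (`±ᵗJ E_δ` is positive definite for `J ∈ S^±`),
  **`exists_transpose_mul_mul_eq_smul_of_conjAct_eq`** (`γJ′γ⁻¹ = J ⇒ ᵗγ (ᵗJE_δ) γ = ν·ᵗJ′E_δ`, `ν` the multiplier).

HC_CM is proved only modulo the 7 printed citations until rung 0 closes; this file proves no cell binder.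

## References
* [Deligne1971TravauxShimura] P. Deligne, *Travaux de Shimura*, Sém. Bourbaki 389 (1971), Prop. 1.15 p. 132, 1.8 p. 129, 0.4 p. 125.
* [Milne2005ShimuraVarieties] J. S. Milne, *Introduction to Shimura varieties* (2005), Prop. 3.5, Lemma 5.13 p. 57, §6 p. 68.
* [CasselsFrohlichANT1967] Cassels–Fröhlich, *Algebraic Number Theory*, Ch. II §14–§15.
-/

noncomputable section

open Matrix NumberField IsDedekindDomain

namespace Literature.AlgebraicGeometry.ModuliOfAbelianVarieties

open SiegelModuli

/-! ### §1. A positive definite real form dominates the squares of the coordinates -/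

/-- For a positive definite real symmetric `S` there is `c > 0` with `c·xᵢ² ≤ ᵗx S x` for all `x` and `i`
(minimum of `ᵗx S x` on the compact unit sphere of the sup norm). [cite: Milne2005ShimuraVarieties, Prop. 3.5] -/
theorem exists_pos_forall_mul_sq_le_of_posDef {n : Type*} [Fintype n] [DecidableEq n] {S : Matrix n n ℝ}
    (hS : S.PosDef) : ∃ c : ℝ, 0 < c ∧ ∀ (x : n → ℝ) (i : n), c * (x i) ^ 2 ≤ x ⬝ᵥ (S *ᵥ x) := by
  rcases isEmpty_or_nonempty n with hn | hn
  · exact ⟨1, one_pos, fun x i => (IsEmpty.false i).elim⟩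
  obtain ⟨i₀⟩ := hn
  set f : (n → ℝ) → ℝ := fun x => x ⬝ᵥ (S *ᵥ x) with hf
  have hfc : Continuous f :=
    continuous_id.dotProduct ((continuous_const.matrix_mulVec continuous_id))
  have hK : IsCompact (Metric.sphere (0 : n → ℝ) 1) := isCompact_sphere 0 1
  have hKne : (Metric.sphere (0 : n → ℝ) 1).Nonempty := by
    refine ⟨Pi.single i₀ 1, ?_⟩
    rw [mem_sphere_zero_iff_norm, Pi.norm_single, norm_one]
  obtain ⟨x₀, hx₀, hmin⟩ := hK.exists_isMinOn hKne hfc.continuousOn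
  have hx₀ne : x₀ ≠ 0 := by
    intro h
    rw [h, mem_sphere_zero_iff_norm, norm_zero] at hx₀
    exact zero_ne_one hx₀
  refine ⟨f x₀, ?_, fun x i => ?_⟩
  · have h := hS.dotProduct_mulVec_pos hx₀ne
    rwa [star_trivial] at h
  · by_cases hx : x = 0
    · rw [hx]; simp
    · have hnx : 0 < ‖x‖ := norm_pos_iff.2 hx
      set u : n → ℝ := ‖x‖⁻¹ • x with hu
      have hu1 : u ∈ Metric.sphere (0 : n → ℝ) 1 := by
        rw [mem_sphere_zero_iff_norm, hu, norm_smul, norm_inv, norm_norm, inv_mul_cancel₀ hnx.ne']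
      have hmin' : f x₀ ≤ f u := hmin hu1
      have hscale : f x = ‖x‖ ^ 2 * f u := by
        simp only [hf, hu, Matrix.mulVec_smul, dotProduct_smul, smul_dotProduct, smul_eq_mul]
        field_simp
      have hxi : (x i) ^ 2 ≤ ‖x‖ ^ 2 := by
        have h1 : |x i| ≤ ‖x‖ := by
          have := norm_le_pi_norm x i
          rwa [Real.norm_eq_abs] at this
        calc (x i) ^ 2 = |x i| ^ 2 := (sq_abs _).symm
          _ ≤ ‖x‖ ^ 2 := pow_le_pow_left₀ (abs_nonneg _) h1 2
      have hf0 : 0 ≤ f x₀ := by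
        have h := hS.dotProduct_mulVec_pos hx₀ne
        rw [star_trivial] at h
        exact h.le
      calc f x₀ * (x i) ^ 2 ≤ f x₀ * ‖x‖ ^ 2 := mul_le_mul_of_nonneg_left hxi hf0
        _ ≤ f u * ‖x‖ ^ 2 := mul_le_mul_of_nonneg_right hmin' (sq_nonneg _)
        _ = f x := by rw [hscale, mul_comm]

/-- The `(i,i)` entry of `ᵗM S M` is the value of the form `S` on the `i`-th column of `M`. [folklore] -/
private theorem transpose_mul_mul_apply_same {n : Type*} [Fintype n] (S M : Matrix n n ℝ) (i : n) :
    (Mᵀ * S * M) i i = (fun k => M k i) ⬝ᵥ (S *ᵥ fun k => M k i) := by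
  simp only [Matrix.mul_apply, Matrix.transpose_apply, dotProduct, Matrix.mulVec, Finset.sum_mul, Finset.mul_sum,
    mul_assoc]
  exact Finset.sum_comm

/-- **Entry bound from `ᵗM S M = r S′`**: if `c·xᵢ² ≤ ᵗx S x` then `c·M_{ki}² ≤ r·S′_{ii}`. [cite: Milne2005ShimuraVarieties, Prop. 3.5] -/
theorem mul_sq_entry_le_of_transpose_mul_mul_eq {n : Type*} [Fintype n] {S S' M : Matrix n n ℝ} {c r : ℝ}
    (hcS : ∀ (x : n → ℝ) (i : n), c * (x i) ^ 2 ≤ x ⬝ᵥ (S *ᵥ x)) (h : Mᵀ * S * M = r • S') (k i : n) :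
    c * (M k i) ^ 2 ≤ r * S' i i := by
  have h1 := hcS (fun l => M l i) k
  rw [← transpose_mul_mul_apply_same, h, Matrix.smul_apply, smul_eq_mul] at h1
  exact h1

/-! ### §2. Finitely many rationals of bounded denominator and size; finitely many such matrices -/

/-- Rationals `q` with `d·q ∈ ℤ` (`d ≠ 0`) and `|q| ≤ B` form a finite set (the «discrete ∩ compact» bookkeeping of the
finiteness of the transporter). [cite: Deligne1971TravauxShimura, proof of Prop. 1.15 p. 132] -/
theorem finite_setOf_rat_den_le {d : ℕ} (hd : d ≠ 0) (B : ℝ) :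
    {q : ℚ | (∃ z : ℤ, (z : ℚ) = d * q) ∧ |(q : ℝ)| ≤ B}.Finite := by
  have hsub : {q : ℚ | (∃ z : ℤ, (z : ℚ) = d * q) ∧ |(q : ℝ)| ≤ B} ⊆
      (fun z : ℤ => (z : ℚ) / d) '' (Set.Icc (-⌈(d : ℝ) * B⌉) ⌈(d : ℝ) * B⌉) := by
    rintro q ⟨⟨z, hz⟩, hq⟩
    refine ⟨z, ?_, ?_⟩
    · have hzR : (z : ℝ) = d * q := by exact_mod_cast hz
      have habs : |(z : ℝ)| ≤ d * B := by
        rw [hzR, abs_mul, Nat.abs_cast]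
        exact mul_le_mul_of_nonneg_left hq (Nat.cast_nonneg d)
      constructor
      · have h1 : -((d : ℝ) * B) ≤ z := (abs_le.1 habs).1
        have h2 : (-⌈(d : ℝ) * B⌉ : ℤ) ≤ z := by
          have : (-( (d:ℝ) * B)) ≤ (z : ℝ) := h1
          have h3 : ⌈-((d : ℝ) * B)⌉ ≤ z := Int.ceil_le.2 this
          have h4 : -⌈(d : ℝ) * B⌉ ≤ ⌈-((d : ℝ) * B)⌉ := by
            rw [neg_le, ← Int.floor_neg, neg_neg]; exact Int.floor_le_ceil _
          exact h4.trans h3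
        exact h2
      · exact Int.cast_le.1 ((abs_le.1 habs).2.trans (Int.le_ceil _))
    · change (z : ℚ) / d = q
      rw [hz, mul_div_cancel_left₀ _ (Nat.cast_ne_zero.2 hd : (d : ℚ) ≠ 0)]
  exact ((Set.finite_Icc _ _).image _).subset hsub

/-- Matrices all of whose entries lie in a finite set form a finite set (entrywise form of the finiteness of the
transporter). [cite: Deligne1971TravauxShimura, proof of Prop. 1.15 p. 132] -/
theorem finite_setOf_forall_entry_mem {m n α : Type*} [Finite m] [Finite n] {A : Set α} (hA : A.Finite) :
    {X : Matrix m n α | ∀ i j, X i j ∈ A}.Finite := by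
  have h1 : {X : Matrix m n α | ∀ i j, X i j ∈ A} = Set.pi Set.univ (fun _ : m => Set.pi Set.univ (fun _ : n => A)) := by
    ext X
    refine ⟨fun h => Set.mem_univ_pi.2 fun i => Set.mem_univ_pi.2 fun j => h i j, fun h i j => ?_⟩
    exact Set.mem_univ_pi.1 (Set.mem_univ_pi.1 h i) j
  rw [h1]
  exact Set.Finite.pi fun _ => Set.Finite.pi fun _ => hA


/-! ### §3. Integral adeles: `𝓞̂` pointwise, common denominators, `⋂ₙ n·𝓞̂ = 0` -/

/-- Membership in `𝓞̂ = ∏_p ℤ_p` (the range of the structure map) is integrality at every place. [cite: CasselsFrohlichANT1967, Ch. II §14] -/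
theorem mem_integralAdeles_iff_forall (x : finAdeleQ) :
    x ∈ FiniteAdeleRing.integralAdeles (𝓞 ℚ) ℚ ↔ ∀ v, x v ∈ v.adicCompletionIntegers ℚ := by
  constructor
  · rintro ⟨y, rfl⟩ v
    exact (y v).2
  · intro h
    exact ⟨fun v => ⟨x v, h v⟩, FiniteAdeleRing.ext ℚ (fun v => rfl)⟩

/-- **Common denominator**: one non-zero natural number clears the entries of `a`, `a⁻¹`, `a′`, `a′⁻¹` for
finite-adelic invertible matrices `a, a′`. [cite: CasselsFrohlichANT1967, Ch. II §14] -/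
theorem exists_nat_forall_mul_entry_mem_integralAdeles {n : Type} [Fintype n] [DecidableEq n] (a a' : GL n finAdeleQ) :
    ∃ d : ℕ, d ≠ 0 ∧ ∀ b : GL n finAdeleQ, (b = a ∨ b = a⁻¹ ∨ b = a' ∨ b = a'⁻¹) → ∀ i j,
      (d : finAdeleQ) * (b : Matrix n n finAdeleQ) i j ∈ FiniteAdeleRing.integralAdeles (𝓞 ℚ) ℚ := by
  classical
  obtain ⟨N, hN0, hN⟩ := Literature.NumberTheory.Adeles.exists_ne_zero_forall_mul_entry_mem ℚ
    ({a, a⁻¹, a', a'⁻¹} : Finset (GL n finAdeleQ))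
  set z : ℤ := Rat.ringOfIntegersEquiv N with hz
  have hz0 : z ≠ 0 := by
    rw [hz]; exact (map_ne_zero_iff _ Rat.ringOfIntegersEquiv.injective).2 hN0
  have hNz : algebraMap (𝓞 ℚ) finAdeleQ N = (z : finAdeleQ) := by
    rw [IsScalarTower.algebraMap_apply (𝓞 ℚ) ℚ finAdeleQ, ← map_intCast (algebraMap ℚ finAdeleQ), hz,
      Rat.ringOfIntegersEquiv_apply_coe]
  refine ⟨z.natAbs, Int.natAbs_ne_zero.2 hz0, fun b hb i j => ?_⟩
  have hbs : b ∈ ({a, a⁻¹, a', a'⁻¹} : Finset (GL n finAdeleQ)) := by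
    simp only [Finset.mem_insert, Finset.mem_singleton]
    tauto
  have hint : (z : finAdeleQ) * (b : Matrix n n finAdeleQ) i j ∈ FiniteAdeleRing.integralAdeles (𝓞 ℚ) ℚ := by
    rw [mem_integralAdeles_iff_forall, ← hNz]
    exact fun v => (Literature.NumberTheory.Automorphic.mem_integralFiniteAdeles_iff.1 (hN b hbs i j)) v
  rcases Int.natAbs_eq z with h | h
  · have hc : ((z.natAbs : ℕ) : finAdeleQ) = (z : finAdeleQ) := by
      conv_rhs => rw [h]
      rw [Int.cast_natCast]
    rw [hc]; exact hint
  · have hc : ((z.natAbs : ℕ) : finAdeleQ) = -(z : finAdeleQ) := by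
      conv_rhs => rw [h]
      rw [Int.cast_neg, Int.cast_natCast, neg_neg]
    rw [hc, neg_mul]; exact neg_mem hint

/-- A rational number `x` with `d·x ∈ 𝓞̂` (read in `𝔸_{ℚ,f}`) has `d·x ∈ ℤ`. [cite: Deligne1971TravauxShimura, 0.4 p. 125] -/
theorem exists_int_cast_eq_mul_of_mem_integralAdeles {d : ℕ} {x : ℚ}
    (h : (d : finAdeleQ) * algebraMap ℚ finAdeleQ x ∈ FiniteAdeleRing.integralAdeles (𝓞 ℚ) ℚ) :
    ∃ z : ℤ, (z : ℚ) = d * x := by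
  apply exists_int_cast_eq_of_algebraMap_mem_integralAdeles
  rwa [map_mul, map_natCast]

/-- Valuation at `v` of the `v`-component of a principal finite adele. [cite: CasselsFrohlichANT1967, Ch. II §14] -/
theorem valued_algebraMap_finAdeleQ_apply (q : ℚ) (v : HeightOneSpectrum (𝓞 ℚ)) :
    Valued.v ((algebraMap ℚ finAdeleQ q) v) = v.valuation ℚ q := by
  rw [FiniteAdeleRing.algebraMap_apply, HeightOneSpectrum.valuedAdicCompletion_eq_valuation']

/-- **`⋂ₙ n·𝓞̂ = 0` in `𝔸_{ℚ,f}`**: a finite adele divisible by every non-zero natural number vanishes (at each prime `p`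
its component is divisible by all powers of `p`). [cite: CasselsFrohlichANT1967, Ch. II §14] -/
theorem eq_zero_of_forall_mem_levelIdeal {x : finAdeleQ} (h : ∀ n : ℕ, n ≠ 0 → x ∈ levelIdeal n) : x = 0 := by
  refine FiniteAdeleRing.ext ℚ (fun v => ?_)
  change x v = 0
  -- a uniformizer at `v`, as a natural number `n`
  obtain ⟨π, hπ⟩ := v.intValuation_exists_uniformizer
  set z : ℤ := Rat.ringOfIntegersEquiv π with hz
  have hπ0 : π ≠ 0 := by
    rintro rfl
    rw [map_zero] at hπ
    exact WithZero.exp_ne_zero hπ.symm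
  have hz0 : z ≠ 0 := by
    rw [hz]; exact (map_ne_zero_iff _ Rat.ringOfIntegersEquiv.injective).2 hπ0
  have hn0 : z.natAbs ≠ 0 := Int.natAbs_ne_zero.2 hz0
  have hvz : v.valuation ℚ (z : ℚ) = WithZero.exp (-1 : ℤ) := by
    rw [hz, Rat.ringOfIntegersEquiv_apply_coe, HeightOneSpectrum.valuation_of_algebraMap, hπ]
  have hvn : v.valuation ℚ (z.natAbs : ℚ) = WithZero.exp (-1 : ℤ) := by
    rcases Int.natAbs_eq z with h1 | h1
    · have h2 : ((z.natAbs : ℕ) : ℚ) = (z : ℚ) := by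
        conv_rhs => rw [h1]
        rw [Int.cast_natCast]
      rw [h2, hvz]
    · have h2 : ((z.natAbs : ℕ) : ℚ) = -(z : ℚ) := by
        conv_rhs => rw [h1]
        rw [Int.cast_neg, Int.cast_natCast, neg_neg]
      rw [h2, Valuation.map_neg, hvz]
  -- `v(x_v) ≤ exp(-k)` for every `k`
  have hle : ∀ k : ℕ, Valued.v (x v) ≤ WithZero.exp (-(k : ℤ)) := by
    intro k
    obtain ⟨y, hy, hxy⟩ := mem_levelIdeal_iff.1 (h (z.natAbs ^ k) (pow_ne_zero k hn0))
    have hcast : ((z.natAbs ^ k : ℕ) : finAdeleQ) = algebraMap ℚ finAdeleQ ((z.natAbs : ℚ) ^ k) := by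
      rw [map_pow, map_natCast, Nat.cast_pow]
    have hxv : x v = (algebraMap ℚ finAdeleQ ((z.natAbs : ℚ) ^ k)) v * y v := by
      rw [← hxy, hcast]; rfl
    have hyv : Valued.v (y v) ≤ 1 :=
      (HeightOneSpectrum.mem_adicCompletionIntegers _ _ _).1 ((mem_integralAdeles_iff_forall y).1 hy v)
    rw [hxv, Valuation.map_mul, valued_algebraMap_finAdeleQ_apply, Valuation.map_pow, hvn, ← WithZero.exp_nsmul,
      smul_neg, nsmul_one]
    exact mul_le_of_le_one_right' hyv
  -- hence `x_v = 0`
  by_contra hx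
  have hx0 : Valued.v (x v) ≠ 0 := (Valuation.ne_zero_iff _).2 hx
  set m : ℤ := WithZero.log (Valued.v (x v)) with hm
  have hk := hle (m.natAbs + 1)
  have hv : Valued.v (x v) = WithZero.exp m := (WithZero.exp_log hx0).symm
  rw [hv, WithZero.exp_le_exp] at hk
  omega

/-- **`⋂ₖ K_δ(N·(k+1)!) = {1}`**: an element of every principal level of the chain is `1`
(its entries minus `δᵢⱼ` are divisible by every `n ≥ 1`, as `n ∣ N·n!`). [cite: Deligne1971TravauxShimura, 1.8 p. 129 and Prop. 1.15 p. 132] -/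
theorem eq_one_of_forall_mem_principalLevelSubgroup {g : ℕ} {δ : Fin g → ℕ} {N : ℕ} {γ : gspFinAdelic δ}
    (h : ∀ k : ℕ, γ ∈ principalLevelSubgroup δ (N * (k + 1).factorial)) : γ = 1 := by
  apply Subtype.ext
  apply Units.ext
  refine Matrix.ext fun i j => ?_
  have hij : ((γ : GL (Fin g ⊕ Fin g) finAdeleQ) : Matrix _ _ finAdeleQ) i j - (1 : Matrix _ _ finAdeleQ) i j = 0 := by
    apply eq_zero_of_forall_mem_levelIdeal
    intro n hn
    have hdvd : n ∣ N * ((n - 1) + 1).factorial := by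
      rw [Nat.sub_add_cancel (Nat.one_le_iff_ne_zero.2 hn)]
      exact Dvd.dvd.mul_left (Nat.dvd_factorial (Nat.pos_of_ne_zero hn) le_rfl) N
    have hmem := (h (n - 1)).1
    rw [← Matrix.sub_apply]
    exact levelIdeal_anti hdvd (hmem i j)
  rw [Subgroup.coe_one, Units.val_one]
  exact sub_eq_zero.1 hij

/-- Set form: `⋂ₖ K_δ(N·(k+1)!) = {1}`. [cite: Deligne1971TravauxShimura, Prop. 1.15 p. 132] -/
theorem iInter_principalLevelSubgroup_factorial {g : ℕ} (δ : Fin g → ℕ) (N : ℕ) :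
    (⋂ k : ℕ, ((principalLevelSubgroup δ (N * (k + 1).factorial) : Subgroup (gspFinAdelic δ)) : Set (gspFinAdelic δ))) =
      {1} := by
  ext γ
  simp only [Set.mem_iInter, SetLike.mem_coe, Set.mem_singleton_iff]
  exact ⟨fun h => eq_one_of_forall_mem_principalLevelSubgroup h, fun h k => h ▸ Subgroup.one_mem _⟩

/-- Triple products keep a common denominator: if `d·A`, `K`, `d·B` are entrywise integral then `d²·(A K B)` is.
[cite: CasselsFrohlichANT1967, Ch. II §14] -/
theorem mul_entry_mul_mul_mem_integralAdeles {n : Type} [Fintype n] {A K B : Matrix n n finAdeleQ} {d : ℕ}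
    (hA : ∀ i j, (d : finAdeleQ) * A i j ∈ FiniteAdeleRing.integralAdeles (𝓞 ℚ) ℚ)
    (hK : ∀ i j, K i j ∈ FiniteAdeleRing.integralAdeles (𝓞 ℚ) ℚ)
    (hB : ∀ i j, (d : finAdeleQ) * B i j ∈ FiniteAdeleRing.integralAdeles (𝓞 ℚ) ℚ) (i j : n) :
    ((d * d : ℕ) : finAdeleQ) * (A * K * B) i j ∈ FiniteAdeleRing.integralAdeles (𝓞 ℚ) ℚ := by
  have h : ((d * d : ℕ) : finAdeleQ) * (A * K * B) i j =
      ∑ q, ∑ p, ((d : finAdeleQ) * A i p) * K p q * ((d : finAdeleQ) * B q j) := by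
    simp only [Matrix.mul_apply, Finset.mul_sum, Finset.sum_mul, Nat.cast_mul]
    refine Finset.sum_congr rfl fun q _ => Finset.sum_congr rfl fun p _ => ?_
    ring
  rw [h]
  exact sum_mem fun q _ => sum_mem fun p _ => mul_mem (mul_mem (hA i p) (hK p q)) (hB q j)

/-! ### §4. The real condition `γ J′ γ⁻¹ = J`: `ᵗγ (ᵗJ E_δ) γ = ν · ᵗJ′ E_δ` -/

section Real

variable {g : ℕ} {δ : Fin g → ℕ}

/-- For `J ∈ S^±` one of `±ᵗJ E_δ` is positive definite. [cite: Milne2005ShimuraVarieties, §6 p. 68] -/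
theorem exists_sign_smul_posDef (J : C0pm δ) :
    ∃ σ : ℝ, (σ = 1 ∨ σ = -1) ∧
      (σ • ((J : Matrix (Fin g ⊕ Fin g) (Fin g ⊕ Fin g) ℝ)ᵀ * realTypeForm δ)).PosDef := by
  rcases J.2 with h | h
  · exact ⟨1, Or.inl rfl, by rw [one_smul]; exact (mem_C0_iff.1 h).2⟩
  · refine ⟨-1, Or.inr rfl, ?_⟩
    have h2 := (mem_C0_iff.1 h).2
    rwa [Matrix.transpose_neg, Matrix.neg_mul, ← neg_one_smul ℝ] at h2

/-- **`γ J′ γ⁻¹ = J` forces `ᵗγ (ᵗJ E_δ) γ = ν·(ᵗJ′ E_δ)`**, `ν ∈ ℚ` the multiplier of `γ ∈ GSp_δ(ℚ)` (read over `ℝ`).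
[cite: Milne2005ShimuraVarieties, §6 p. 68 and Prop. 3.5] -/
theorem exists_transpose_mul_mul_eq_smul_of_conjAct_eq (γ : gspRational δ) (J J' : C0pm δ)
    (hJ : conjAct δ (gspRationalToReal δ γ) J' = J) :
    ∃ ν : ℚ,
      ((((γ : GL (Fin g ⊕ Fin g) ℚ) : Matrix (Fin g ⊕ Fin g) (Fin g ⊕ Fin g) ℚ).map (algebraMap ℚ ℝ)))ᵀ *
          (((J : Matrix (Fin g ⊕ Fin g) (Fin g ⊕ Fin g) ℝ))ᵀ * realTypeForm δ) *
          (((γ : GL (Fin g ⊕ Fin g) ℚ) : Matrix (Fin g ⊕ Fin g) (Fin g ⊕ Fin g) ℚ).map (algebraMap ℚ ℝ)) =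
        (ν : ℝ) • (((J' : Matrix (Fin g ⊕ Fin g) (Fin g ⊕ Fin g) ℝ))ᵀ * realTypeForm δ) := by
  set M : Matrix (Fin g ⊕ Fin g) (Fin g ⊕ Fin g) ℝ :=
    (((γ : GL (Fin g ⊕ Fin g) ℚ) : Matrix (Fin g ⊕ Fin g) (Fin g ⊕ Fin g) ℚ).map (algebraMap ℚ ℝ)) with hM
  have hMcoe : ((gspRationalToReal δ γ : gspReal δ) : GL (Fin g ⊕ Fin g) ℝ) = Matrix.GeneralLinearGroup.map (algebraMap ℚ ℝ) γ :=
    coe_gspRationalToReal δ γ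
  have hMval : ((Matrix.GeneralLinearGroup.map (algebraMap ℚ ℝ) (γ : GL (Fin g ⊕ Fin g) ℚ) : GL (Fin g ⊕ Fin g) ℝ) :
      Matrix (Fin g ⊕ Fin g) (Fin g ⊕ Fin g) ℝ) = M :=
    Matrix.ext fun i j => Matrix.GeneralLinearGroup.map_apply (algebraMap ℚ ℝ) i j _
  -- `M J' = J M`
  have hcomm : M * (J' : Matrix (Fin g ⊕ Fin g) (Fin g ⊕ Fin g) ℝ) = (J : Matrix (Fin g ⊕ Fin g) (Fin g ⊕ Fin g) ℝ) * M := by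
    have h1 := congrArg (fun X : C0pm δ => (X : Matrix (Fin g ⊕ Fin g) (Fin g ⊕ Fin g) ℝ)) hJ
    simp only [coe_conjAct, conjJ_def, hMcoe] at h1
    have h2 := congrArg (fun X => X * M) h1
    rw [Matrix.mul_assoc, ← hMval, Matrix.coe_units_inv, Matrix.nonsing_inv_mul _ (Matrix.isUnits_det_units _), Matrix.mul_one]
      at h2
    rw [← hMval]; exact h2
  obtain ⟨ν, hν⟩ := mem_similitudeGroupOfForm_iff.1 γ.2
  have hνR : Mᵀ * realTypeForm δ * M = ((ν : ℚ) : ℝ) • realTypeForm δ := by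
    have h := congrArg (fun X : Matrix (Fin g ⊕ Fin g) (Fin g ⊕ Fin g) ℚ => X.map (algebraMap ℚ ℝ)) hν
    rw [Matrix.map_mul, Matrix.map_mul, Matrix.transpose_map, typeFormOver_map,
      Matrix.map_smul' _ _ _ (map_mul (algebraMap ℚ ℝ)), typeFormOver_map, typeFormOver_real_eq_realTypeForm,
      eq_ratCast] at h
    rw [hM]
    exact h
  refine ⟨ν, ?_⟩
  calc Mᵀ * ((J : Matrix _ _ ℝ)ᵀ * realTypeForm δ) * M
      = ((J : Matrix _ _ ℝ) * M)ᵀ * realTypeForm δ * M := by simp only [Matrix.transpose_mul, Matrix.mul_assoc]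
    _ = (M * (J' : Matrix _ _ ℝ))ᵀ * realTypeForm δ * M := by rw [hcomm]
    _ = (J' : Matrix _ _ ℝ)ᵀ * (Mᵀ * realTypeForm δ * M) := by
        simp only [Matrix.transpose_mul, Matrix.mul_assoc]
    _ = ((ν : ℚ) : ℝ) • ((J' : Matrix _ _ ℝ)ᵀ * realTypeForm δ) := by rw [hνR, Matrix.mul_smul]

end Real

end Literature.AlgebraicGeometry.ModuliOfAbelianVarieties

end
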